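import Summits.CriticalPhenomena.SAWScalingLimit.Theorems.SAWTotalPositivityBoundaryTP2Defs
import Summits.CriticalPhenomena.SAWScalingLimit.Theorems.SAWTotalPositivityBoundaryTP2Symmetry
import Summits.CriticalPhenomena.SAWScalingLimit.Theorems.SAWTotalPositivityBoundaryTP2RectReflect
import Summits.CriticalPhenomena.SAWScalingLimit.Theorems.SAWTotalPositivityBoundaryTP2LadderMinorCB
import Summits.CriticalPhenomena.SAWScalingLimit.Theorems.SAWTotalPositivityBoundaryTP2LadderBbttNested2
import Summits.CriticalPhenomena.SAWScalingLimit.Theorems.SAWTotalPositivityBoundaryTP2LadderBbttNested3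
import Summits.CriticalPhenomena.SAWScalingLimit.Theorems.SAWTotalPositivityBoundaryTP2LadderBbttNested7
import Summits.CriticalPhenomena.SAWScalingLimit.Theorems.SAWTotalPositivityBoundaryTP2LadderFacingRungs
import Summits.CriticalPhenomena.SAWScalingLimit.Theorems.SAWTotalPositivityBoundaryTP2LadderBbtt9Nested
import Summits.CriticalPhenomena.SAWScalingLimit.Theorems.EdgeOfPositivity.Negative.EdgeOfPositivityRectDomain
import HarnessLib

/-!
# Crux `BoundaryTP2` (stmt-CriticalPhenomena-7115), line `Sketch`: the counter-clockwise
bottom-bottom-top-top quadruples of a ladder, crossing pairing vs NESTED pairing (dispatcher)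

Stub `ladder_ccw_bbtt_nested` of the line's skeleton. On the ladder
`R_L = discreteDomainGraph (rectDomain L 1) 1` (sites `{0..L} × {0,1}`) write `Z = pathKernel R_L x` and
`T(c,d) = Z((c,0),(d,1))` for the bottom-to-top kernel. For two bottom sites `(c₁,0), (c₂,0)` with
`c₁ < c₂ ≤ L`, two top sites `(d₁,1), (d₂,1)` with `d₂ < d₁ ≤ L` (the counter-clockwise quadruple
`(c₁,0), (c₂,0), (d₁,1), (d₂,1)`; EVERY interleaving of the columns, ties `cᵢ = dⱼ` included) and every
fugacity `0 ≤ x ≤ 1/2`: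

  `T(c₁,d₁) · T(c₂,d₂) ≤ T(c₁,d₂) · T(c₂,d₁)`      (crossing ≤ nested).

Proof (case analysis over landed lemmas, no new analysis).

* *Symmetries.* By the row reflection `(i,j) ↦ (i,1-j)` of the box (`stub_rect_reflect`, second
  conjunct) and reversal (`pathKernel_comm`), `T(a,b) = T(b,a)` (`ccwN_T_symm`); by the column reflection
  `(i,j) ↦ (L-i,j)` (`stub_rect_reflect`, first conjunct), `T(L-a,L-b) = T(a,b)` (`ccwN_col`). The swap
  `(c₁,c₂,d₂,d₁) ↦ (d₂,d₁,c₁,c₂)` maps the claim to itself through `T(a,b) = T(b,a)`, and every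
  configuration either satisfies `c₁ < d₂ ∨ (c₁ = d₂ ∧ c₂ ≤ d₁)` or its swap does; so it suffices to treat
  that half (`ccwN_half`), which the main theorem then transports.
* *The half `c₁ < d₂ ∨ (c₁ = d₂ ∧ c₂ ≤ d₁)`.*
  `c₁ < c₂ < d₂ < d₁`: the column-separated minor `stub_ladder_minorCB` (bottom pair strictly left of the
  top pair); `c₁ < c₂ = d₂ < d₁`: `stub_ladder_bbtt9_nested`; `c₁ < d₂ < c₂ < d₁`:
  `stub_ladder_bbtt_nested2`; `c₁ < d₂ < d₁ < c₂`: `stub_ladder_bbtt_nested3`; `c₁ < d₂ < c₂ = d₁`: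
  `stub_ladder_bbtt_nested7` applied to the columns `(L-c₂, L-d₂, L-c₁)` and pulled back by `ccwN_col`
  and `ccwN_T_symm`; `c₁ = d₂ < c₂ < d₁`: `stub_ladder_bbtt_nested7` verbatim; `c₁ = d₂ < c₂ = d₁`:
  `stub_ladder_facingRungs`.
-/

noncomputable section

namespace Summit.CriticalPhenomena.SAWScalingLimit.Theorems.BoundaryTP2

open Literature.Probability.LatticeModels Literature.Probability.RandomPlanarGeometry
open Summit.CriticalPhenomena.SAWScalingLimit.Theorems.EdgeOfPositivity.Negative
open scoped ENNReal

/-! ## The two reflections on the bottom-to-top kernel -/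

/-- The bottom-to-top kernel of the ladder is symmetric in its two columns:
`Z((a,0),(b,1)) = Z((b,0),(a,1))` (row reflection followed by reversal). [folklore] -/
private theorem ccwN_T_symm (L : ℕ) (x : ℝ) (a b : ℤ) :
    pathKernel (discreteDomainGraph (rectDomain L 1) 1) x (st a 0) (st b 1) =
      pathKernel (discreteDomainGraph (rectDomain L 1) 1) x (st b 0) (st a 1) := by
  have h := (stub_rect_reflect L 1 x a 0 b 1).2
  simp only [Nat.cast_one, sub_zero, sub_self] at h
  exact h.trans (pathKernel_comm _ _ _ _)

/-- The bottom-to-top kernel of the ladder is invariant under the column reflection `c ↦ L - c`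
(stated at natural-number columns `a, b ≤ L`). [folklore] -/
private theorem ccwN_col (L : ℕ) (x : ℝ) (a b : ℕ) (ha : a ≤ L) (hb : b ≤ L) :
    pathKernel (discreteDomainGraph (rectDomain L 1) 1) x (st ((L - a : ℕ) : ℤ) 0)
        (st ((L - b : ℕ) : ℤ) 1) =
      pathKernel (discreteDomainGraph (rectDomain L 1) 1) x (st a 0) (st b 1) := by
  rw [(stub_rect_reflect L 1 x a 0 b 1).1, Nat.cast_sub ha, Nat.cast_sub hb]

/-! ## One half of the interleavings -/

/-- The nested-pairing inequality `T(c₁,d₁) T(c₂,d₂) ≤ T(c₁,d₂) T(c₂,d₁)` for the interleavings with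
`c₁ < d₂`, or with `c₁ = d₂` and `c₂ ≤ d₁` (the other interleavings are their images under the swap of
the bottom pair with the top pair). [folklore] -/
private theorem ccwN_half (L : ℕ) {c₁ c₂ d₁ d₂ : ℕ} (h₁₂ : c₁ < c₂) (h₂ : c₂ ≤ L) (hd : d₂ < d₁)
    (hd₁ : d₁ ≤ L) (hH : c₁ < d₂ ∨ (c₁ = d₂ ∧ c₂ ≤ d₁)) {x : ℝ} (hx0 : 0 ≤ x) (hx : x ≤ 1 / 2) :
    pathKernel (discreteDomainGraph (rectDomain L 1) 1) x (st c₁ 0) (st d₁ 1) *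
        pathKernel (discreteDomainGraph (rectDomain L 1) 1) x (st c₂ 0) (st d₂ 1) ≤
      pathKernel (discreteDomainGraph (rectDomain L 1) 1) x (st c₁ 0) (st d₂ 1) *
        pathKernel (discreteDomainGraph (rectDomain L 1) 1) x (st c₂ 0) (st d₁ 1) := by
  rcases hH with hlt | ⟨h₁₁, h₂₁⟩
  · -- `c₁ < d₂`
    rcases lt_trichotomy c₂ d₂ with h₂₂ | h₂₂ | h₂₂
    · -- `c₁ < c₂ < d₂ < d₁`: the bottom pair is strictly left of the top pair
      exact stub_ladder_minorCB L (Or.inl rfl) (Or.inl rfl) (Or.inr rfl) (Or.inr rfl) (by omega) hd₁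
        (by omega) (Or.inr (Or.inl ⟨rfl, rfl, h₁₂⟩)) (Or.inr (Or.inr ⟨rfl, rfl, hd⟩)) hx0 hx
    · -- `c₁ < c₂ = d₂ < d₁`
      subst d₂
      exact stub_ladder_bbtt9_nested L h₁₂ hd hd₁ hx0 hx
    · -- `c₁ < d₂ < c₂`
      rcases lt_trichotomy c₂ d₁ with h₂₃ | h₂₃ | h₂₃
      · -- `c₁ < d₂ < c₂ < d₁`
        exact stub_ladder_bbtt_nested2 L hlt h₂₂ h₂₃ hd₁ hx0 hx
      · -- `c₁ < d₂ < c₂ = d₁`: `nested7` at the reflected columns `L - c₂ < L - d₂ < L - c₁`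
        subst d₁
        have h := stub_ladder_bbtt_nested7 L (c₁ := L - c₂) (c₂ := L - d₂) (d₁ := L - c₁)
          (by omega) (by omega) (by omega) hx0 hx
        rw [ccwN_col L x c₂ c₁ h₂ (by omega), ccwN_col L x d₂ c₂ (by omega) h₂,
          ccwN_col L x c₂ c₂ h₂ h₂, ccwN_col L x d₂ c₁ (by omega) (by omega),
          ccwN_T_symm L x c₂ c₁, ccwN_T_symm L x d₂ c₂, ccwN_T_symm L x d₂ c₁] at h
        exact h.trans_eq (mul_comm _ _)
      · -- `c₁ < d₂ < d₁ < c₂`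
        exact stub_ladder_bbtt_nested3 L hlt hd h₂₃ h₂ hx0 hx
  · -- `c₁ = d₂` and `c₂ ≤ d₁`
    subst d₂
    rcases h₂₁.lt_or_eq with h₂₃ | h₂₃
    · -- `c₁ = d₂ < c₂ < d₁`
      exact stub_ladder_bbtt_nested7 L h₁₂ h₂₃ hd₁ hx0 hx
    · -- `c₁ = d₂ < c₂ = d₁`: two facing rungs
      subst d₁
      exact stub_ladder_facingRungs L h₁₂ h₂ hx0 hx

/-! ## The dispatcher -/

/-- **Nested pairing for the counter-clockwise bottom-bottom-top-top quadruples of a ladder.** On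
`R_L = {0..L} × {0,1}`, for bottom sites `(c₁,0), (c₂,0)` with `c₁ < c₂ ≤ L`, top sites `(d₁,1), (d₂,1)`
with `d₂ < d₁ ≤ L` (every interleaving of the columns, ties included) and `0 ≤ x ≤ 1/2`:
`Z((c₁,0),(d₁,1)) · Z((c₂,0),(d₂,1)) ≤ Z((c₁,0),(d₂,1)) · Z((c₂,0),(d₁,1))`. Dispatcher over
`stub_ladder_minorCB`, `stub_ladder_bbtt_nested2/3/7`, `stub_ladder_bbtt9_nested`,
`stub_ladder_facingRungs` and their images under the reflections of the box. [folklore] -/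
theorem ladder_ccw_bbtt_nested (L : ℕ) {c₁ c₂ d₁ d₂ : ℕ} (h₁₂ : c₁ < c₂) (h₂ : c₂ ≤ L) (hd : d₂ < d₁)
    (hd₁ : d₁ ≤ L) {x : ℝ} (hx0 : 0 ≤ x) (hx : x ≤ 1 / 2) :
    pathKernel (discreteDomainGraph (rectDomain L 1) 1) x (st c₁ 0) (st d₁ 1) *
        pathKernel (discreteDomainGraph (rectDomain L 1) 1) x (st c₂ 0) (st d₂ 1) ≤
      pathKernel (discreteDomainGraph (rectDomain L 1) 1) x (st c₁ 0) (st d₂ 1) *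
        pathKernel (discreteDomainGraph (rectDomain L 1) 1) x (st c₂ 0) (st d₁ 1) := by
  by_cases hH : c₁ < d₂ ∨ (c₁ = d₂ ∧ c₂ ≤ d₁)
  · exact ccwN_half L h₁₂ h₂ hd hd₁ hH hx0 hx
  · -- the swapped configuration `(d₂, d₁ ; c₁, c₂)` lies in the treated half
    have h := ccwN_half L hd hd₁ h₁₂ h₂ (by omega) hx0 hx
    rw [ccwN_T_symm L x d₂ c₂, ccwN_T_symm L x d₁ c₁, ccwN_T_symm L x d₂ c₁,
      ccwN_T_symm L x d₁ c₂] at h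
    exact (mul_comm _ _).trans_le h

end Summit.CriticalPhenomena.SAWScalingLimit.Theorems.BoundaryTP2
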